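import Summits.Ventures.CertifiedManyBodySolver.Downfold.EmeryBoxesYBCO6K26ThermalCapRetiltMarkovBoxp1
import Summits.Ventures.CertifiedManyBodySolver.Downfold.EmeryBoxesYBCO6K26ThermalFloorAtlasWord
import Summits.Ventures.CertifiedManyBodySolver.Downfold.EmeryThermalAtomicFloor
import HarnessLib

/-!
# HIGH-TEMPERATURE-CLOSING `T > 0` WINDOW on YBa2Cu3O6.00 (M64; #139 bilayer PARENT) plane Cu(2) — U-SLICE «(K) 66» (U_dd, U_pp) = (5.0 — `emeryBoxYBCO6K26` (router/EMERY-FLOOR-ORDERS row 44): the ATOMIC-LIMIT floor (full entropy) ∨ the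
# family floor, against the re-tilted cap — both sides meet at `6 log 2` as β → 0

Venture CertifiedManyBodySolver, cell `pub/hubbard-downfold` (S1 = ROUTER) × crew hubbard-fast S2 (ii) × (iv) «T > 0 × multi-band» (D-0096 (ii)); seat hubbard-downfold-mod-4
(S1/S2 Emery seam, g17). Namespace `Summit.Ventures.CertifiedManyBodySolver.Downfold`. DOOR: `EmeryThermalAtomicFloor` (`holdsOn_emeryCellPressureAtomicFloor`: Peierls on the
whole occupation basis of the `Cu₄O₈` block, site-wise factorisation; the one-site function is the tree's `atomicPartitionFnReal β U μ`). INPUTS BY NAME: the family floor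
`emeryBoxYBCO6K26_pressureFloorFam_m93o10` (`EmeryBoxesYBCO6K26ThermalFloorAtlasWord`; C = (-142.264191, -142.691598)), the cap `emeryBoxYBCO6K26_pressureCap_m93o10_retilt` (`EmeryBoxesYBCO6K26ThermalCapRetiltMarkovBoxp1`; `6 log 2 + 40.2438·β`; flat word 43.4438).
ATOMIC DATA: Cu at `μ_d = −(εp + Δ_hi) = 599/100`, `U_d,hi = 5057/1000`; O at `μ_p = −εp = 93/10`, `U_p,hi = 2171/500` ⇒ classical slope 35.4390·β (family slope 35.6729; cap 40.2438).
RESULT: **`emeryBoxYBCO6K26_pressureWindowHighT_m93o10`**: `max(atomic, family) ≤ P_cell ≤ 6 log 2 + 40.2438·β` on the whole box, every β ≥ 0; width → 0 as β → 0 (both sides `6 log 2`,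
`emeryBoxYBCO6K26_pressure_beta_zero_m93o10`); crossover β* ≈ 1.400 (T* ≈ 8291 K) below which the atomic floor is the better floor [float].

Everything PROVED (0 sorry); no definition. HONEST FRAMING: CERTIFIED inequalities on a SCREENING/EXTRAPOLATED-grade object; the atomic floor ignores hopping (its slope sits
0.2339 below the family floor's), so at physical temperatures (β ≈ 20–40 eV⁻¹) the family floor still decides and thermal scales are NOT resolved there; what is new
is the correct INFINITE-TEMPERATURE closure of the window and a certified high-T regime (β ≲ β*) with width `≈ 4.8048·β`; grand-canonical at the stated level; no phase word;
no router number moves. WHAT-THIS-IS-NOT: a new certificate (pure algebra on landed objects; zero kit).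
-/

noncomputable section

namespace Summit.Ventures.CertifiedManyBodySolver.Downfold

open NonemptyInterval Matrix Finset Literature.Probability.LatticeModels
open Literature.MathematicalPhysics.QuantumLattice Literature.Computation.Certificates
open Summit.Ventures.CertifiedManyBodySolver.Certificates OccupationCode ClusterLowerBound
open scoped BigOperators ComplexOrder

/-! ## §1 The atomic-limit floor on the box at εp = -93/10 -/

/-- **ATOMIC-LIMIT `T > 0` FLOOR** on the whole `emeryBoxYBCO6K26`, cuprate signs, level εp = -93/10 (chemical potential 93/10 eV), EVERY β ≥ 0:
`log z₀(β; U_d = 5057/1000, μ_d = 599/100) + 2·log z₀(β; U_p = 2171/500, μ_p = 93/10) ≤ P_cell` with `z₀(β; U, μ) = 1 + 2e^{βμ} + e^{−β(U−2μ)}` (`atomicPartitionFnReal`; Cu at the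
box's upper level `εp + Δ_hi = -599/100` and `U_d,hi`, O at `εp` and `U_p,hi`). Value `6 log 2` at β = 0; slope `35.4390·β` as β → ∞ (classical minimum, no hopping).
[cite: Ruelle1969, §2.5–2.6] [cite: Ueltschi1999, §3] -/
theorem emeryBoxYBCO6K26_pressureAtomicFloor_m93o10 {β : ℝ} (hβ : 0 ≤ β) :
    HoldsOn (fun p : EmeryCoord → ℝ => Real.log (atomicPartitionFnReal β (5057/1000 : ℝ) (599/100 : ℝ)) + 2 * Real.log (atomicPartitionFnReal β (2171/500 : ℝ) (93/10 : ℝ)) ≤ emeryCellPressure β (emeryLine cuprateSigns (emeryLineCoords (((-93/10 : ℚ)) : ℝ) p))) emeryBoxYBCO6K26 := by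
  intro p hp
  have h := holdsOn_emeryCellPressureAtomicFloor (E := emeryBoxYBCO6K26) (eA := ybco6K26Emery_tpd) (eB := ybco6K26Emery_tpp) (eD := ybco6K26Emery_Delta) (eUd := ybco6K26Emery_Udd) (eUp := ybco6K26Emery_Upp) (-93/10) (by simp [emeryBoxYBCO6K26, emeryBoxYBCO6K26Src, Function.update]) (by simp [emeryBoxYBCO6K26, emeryBoxYBCO6K26Src, Function.update]) (Function.update_self _ _ _) (by simp [emeryBoxYBCO6K26, emeryBoxYBCO6K26Src, Function.update]) (by simp [emeryBoxYBCO6K26, emeryBoxYBCO6K26Src, Function.update]) cuprateSigns hβ p hp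
  simp only [ybco6K26Emery_Delta, ybco6K26Emery_Udd, ybco6K26Emery_Upp, Entry.encl_ofEnds_snd] at h
  push_cast at h
  norm_num at h ⊢
  exact h

/-! ## §2 The best floor and the HIGH-TEMPERATURE-CLOSING window -/

/-- **BEST `T > 0` FLOOR = max(atomic, family)** on the whole box at εp = -93/10, every β ≥ 0: the atomic floor (full entropy, slope 35.4390) wins for
β < β* ≈ 1.400 (T > 8291 K), the family floor `emeryBoxYBCO6K26_pressureFloorFam_m93o10` (slope 35.6729, entropy ¼·log 2) for β > β*. [cite: Ruelle1969, §2.5–2.6] [cite: Israel1979, Lemma II.3.1] -/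
theorem emeryBoxYBCO6K26_pressureFloorBest_m93o10 {β : ℝ} (hβ : 0 ≤ β) :
    HoldsOn (fun p : EmeryCoord → ℝ => max (Real.log (atomicPartitionFnReal β (5057/1000 : ℝ) (599/100 : ℝ)) + 2 * Real.log (atomicPartitionFnReal β (2171/500 : ℝ) (93/10 : ℝ))) (Real.log (Real.exp (-(β * (-142264191/1000000 : ℝ))) + Real.exp (-(β * (-71345799/500000 : ℝ)))) / 4) ≤ emeryCellPressure β (emeryLine cuprateSigns (emeryLineCoords (((-93/10 : ℚ)) : ℝ) p))) emeryBoxYBCO6K26 :=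
  fun p hp => max_le (emeryBoxYBCO6K26_pressureAtomicFloor_m93o10 hβ p hp) (emeryBoxYBCO6K26_pressureFloorFam_m93o10 hβ p hp)

/-- **THE HIGH-TEMPERATURE-CLOSING TWO-SIDED `T > 0` WINDOW** (hypothesis-free on both sides) on the whole `emeryBoxYBCO6K26`, level εp = -93/10, EVERY β ≥ 0:
`max(atomic, family) ≤ P_cell ≤ 6 log 2 + β·1287803/32000` (cap = `emeryBoxYBCO6K26_pressureCap_m93o10_retilt`, hubbard-box-p1 re-tilted). BOTH SIDES EQUAL `6 log 2` AT β = 0; the width is `O(β)` for small β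
(slope gap 4.8048 against the atomic floor, 4.5709 against the family floor). Table [float; `T = 11604.5/β` K]:
| β (1/eV) | T (K) | atomic floor | family floor | best floor | cap | width |
|---|---|---|---|---|---|---|
| 0.01 | 1160450 | 4.3734 | 0.5295 | 4.3734 | 4.5613 | 0.1879 |
| 0.1 | 116045 | 6.5436 | 3.7353 | 6.5436 | 8.1833 | 1.6396 |
| 0.5 | 23209 | 18.8576 | 17.9844 | 18.8576 | 24.2808 | 5.4232 |
| 1 | 11604 | 36.0479 | 35.7984 | 36.0479 | 44.4027 | 8.3549 |
| 2 | 5802 | 71.1478 | 71.4344 | 71.4344 | 84.6466 | 13.2122 |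
| 5 | 2321 | 177.2137 | 178.3924 | 178.3924 | 205.3781 | 26.9857 |
| 10 | 1160 | 354.3902 | 356.7325 | 356.7325 | 406.5973 | 49.8649 |
| 20 | 580 | 708.7800 | 713.4580 | 713.4580 | 809.0358 | 95.5777 |
| 40 | 290 | 1417.5600 | 1426.9160 | 1426.9160 | 1613.9126 | 186.9967 |
[cite: Israel1979, Thm. I.2.4] [cite: Ruelle1969, §2.5–2.6] [cite: Ueltschi1999, §3] -/
theorem emeryBoxYBCO6K26_pressureWindowHighT_m93o10 {β : ℝ} (hβ : 0 ≤ β) :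
    HoldsOn (fun p : EmeryCoord → ℝ =>
      max (Real.log (atomicPartitionFnReal β (5057/1000 : ℝ) (599/100 : ℝ)) + 2 * Real.log (atomicPartitionFnReal β (2171/500 : ℝ) (93/10 : ℝ))) (Real.log (Real.exp (-(β * (-142264191/1000000 : ℝ))) + Real.exp (-(β * (-71345799/500000 : ℝ)))) / 4) ≤ emeryCellPressure β (emeryLine cuprateSigns (emeryLineCoords (((-93/10 : ℚ)) : ℝ) p)) ∧
      emeryCellPressure β (emeryLine cuprateSigns (emeryLineCoords (((-93/10 : ℚ)) : ℝ) p)) ≤ 6 * Real.log 2 + β * (1287803/32000 : ℝ)) emeryBoxYBCO6K26 :=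
  fun p hp => ⟨emeryBoxYBCO6K26_pressureFloorBest_m93o10 hβ p hp, by simpa using emeryBoxYBCO6K26_pressureCap_m93o10_retilt hβ p hp⟩

/-- **At β = 0 the window is a point**: `P_cell(0, ·) = 6 log 2` on the whole box (floor and cap coincide). [cite: Ueltschi1999, §3] -/
theorem emeryBoxYBCO6K26_pressure_beta_zero_m93o10 :
    HoldsOn (fun p : EmeryCoord → ℝ => emeryCellPressure 0 (emeryLine cuprateSigns (emeryLineCoords (((-93/10 : ℚ)) : ℝ) p)) = 6 * Real.log 2) emeryBoxYBCO6K26 := by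
  intro p hp
  have h := emeryBoxYBCO6K26_pressureWindowHighT_m93o10 le_rfl p hp
  rw [atomicPartitionFnReal_beta_zero, atomicPartitionFnReal_beta_zero, show (4 : ℝ) = 2 ^ 2 by norm_num, Real.log_pow] at h
  push_cast at h
  have h1 := (le_max_left _ _).trans h.1
  linarith [h.2]

end Summit.Ventures.CertifiedManyBodySolver.Downfold

end
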